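import Mathlib.NumberTheory.LSeries.Deriv
import Mathlib.NumberTheory.LSeries.Positivity
import Mathlib.NumberTheory.LSeries.Linearity
import Mathlib.Analysis.SpecialFunctions.Complex.LogBounds
import Mathlib.Analysis.Complex.ExponentialBounds
import Literature.Analysis.Complex.LogDerivZeros
import HarnessLib

/-!
# The classical zero-free region (de la Vallée-Poussin–Landau method), axiomatised

Topic `Literature/NumberTheory/LFunctions`. Everything in this file is PROVED.

We isolate the hypotheses under which the classical proof of the zero-free region
`σ > 1 − c/log(|t| + 4)` (de la Vallée-Poussin 1899; Landau 1903 for `ζ_K`; Montgomery–Vaughan,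
*Multiplicative Number Theory I*, §6.1, Theorems 6.6 and 6.7, and p. 267 for `ζ_K`) goes through,
and carry the proof out once, for an abstract pair `(Λ, G)`:

* `Λ : ℕ → ℝ`, `Λ ≥ 0`, `Λ(1) = 0`, with `∑ Λ(n) n^{-s}` absolutely convergent for `σ > 1`
  (think `Λ` = von Mangoldt's function, or `Λ_K(n) = ∑_{N𝔭^m = n} log N𝔭`);
* `G` holomorphic on a half-plane `σ > 1 − η` (`0 < η ≤ 1`), non-vanishing on `σ > 1` with
  `G'/G(s) = 1/(s − 1) − ∑ Λ(n) n^{-s}` there (think `G(s) = (s − 1)ζ(s)` or `(s − 1)ζ_K(s)`, so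
  that `−ζ'/ζ = ∑ Λ n^{-s}`), `G(1) ≠ 0` (a genuine simple pole of `ζ = G/(s−1)`), and of
  polynomial growth `|G(s)| ≤ C (|t| + 4)^A` in `1 − η < σ ≤ 3`.

This is `Literature.ClassicalZFRData Λ G η`. Under it we prove

* `ClassicalZFRData.zeroFree` — **MV Theorem 6.6 / p. 267**: there is `c > 0` with `G(s) ≠ 0`
  for `σ > 1 − η`, `σ > 1 − c/log(|t| + 4)`;
* `ClassicalZFRData.norm_logDeriv_le` — **MV Theorem 6.7 (6.6)**: there are `c > 0` and `C` with
  `|G'/G(s)| ≤ C log(|t| + 4)` for `σ > 1 − η`, `σ ≥ 1 − c/log(|t| + 4)`.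

The analytic engine is Titchmarsh's Lemma α of §3.9 (E. Landau, Math. Z. 20 (1924)), in the tree
as `Literature.Analysis.Complex.titchmarsh_logDeriv_sub_sum_of_differentiableOn`
(`Literature/Analysis/Complex/LogDerivZeros.lean`), together with the `3-4-1` inequality
(MV Lemma 6.5) for `∑ Λ(n) n^{-s}`, `Λ ≥ 0`. The lower bound for `|G|` slightly to the right of
`σ = 1` that the method needs ("`|f(0)| ≫ 1` by the Euler product", MV p. 172) is obtained here
without an Euler product, from `Λ ≥ 0` alone: `G(s) = C (s − 1) exp(∑_{n ≥ 2} Λ(n) n^{-s}/log n)`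
on `σ > 1` (`ClassicalZFRData.norm_apply_ge`).

Specialisations (in other files): `G(s) = (s − 1)ζ(s)` (Mathlib's `riemannZeta`; the classical
region of de la Vallée-Poussin) and `G(s) = (s − 1)ζ_K(s)` (Landau's continuation of the Dedekind
zeta function, `DedekindZetaHalfPlane.lean`; the input of the prime ideal theorem).

## References

* H. L. Montgomery, R. C. Vaughan, *Multiplicative Number Theory I. Classical Theory*, Cambridge
  Stud. Adv. Math. 97 (2007), §6.1: Lemmas 6.3–6.5, Theorems 6.6, 6.7; §8.4 p. 267
  (`MontgomeryVaughan2007`).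
* E. Landau, *Neuer Beweis des Primzahlsatzes und Beweis des Primidealsatzes*, Math. Ann. 56
  (1903), 645–670, §§10–11 (`LandauMathAnn1903`).
* E. C. Titchmarsh, *The Theory of the Riemann Zeta-Function*, 2nd ed. (1986), §3.9 Lemma α,
  Theorem 3.10 (`Titchmarsh1986`).
-/

noncomputable section

open Complex Filter Topology Metric Set Finset
open scoped ComplexOrder

namespace Literature.NumberTheory.LFunctions

/-! ## The hypotheses -/

/-- **Hypotheses of the classical zero-free-region argument** for a pair `(Λ, G)`:
`Λ ≥ 0`, `Λ(1) = 0`, `∑ Λ(n) n^{-s}` absolutely convergent for `σ > 1`; `G` holomorphic on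
`σ > 1 − η` (`0 < η ≤ 1`), `G ≠ 0` and `G'/G = 1/(s−1) − ∑ Λ(n) n^{-s}` on `σ > 1`, `G(1) ≠ 0`, and
`|G(s)| ≤ C (|t|+4)^A` for `1 − η < σ ≤ 3`. Model: `G(s) = (s − 1) ζ_K(s)`, `Λ = Λ_K`
(Montgomery–Vaughan p. 267; Landau 1903 §§9–11). [cite: MontgomeryVaughan2007, §6.1 and p. 267] -/
structure ClassicalZFRData (Λ : ℕ → ℝ) (G : ℂ → ℂ) (η : ℝ) : Prop where
  /-- `0 < η`. -/
  eta_pos : 0 < η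
  /-- `η ≤ 1`. -/
  eta_le_one : η ≤ 1
  /-- `Λ ≥ 0`. -/
  nonneg : ∀ n, 0 ≤ Λ n
  /-- `Λ(1) = 0`. -/
  map_one : Λ 1 = 0
  /-- `∑ Λ(n) n^{-s}` converges absolutely for `σ > 1`. -/
  summable : ∀ s : ℂ, 1 < s.re → LSeriesSummable (fun n ↦ (Λ n : ℂ)) s
  /-- `G` is holomorphic on `σ > 1 − η`. -/
  differentiableOn : DifferentiableOn ℂ G {s : ℂ | 1 - η < s.re}
  /-- `G ≠ 0` on `σ > 1`. -/
  ne_zero : ∀ s : ℂ, 1 < s.re → G s ≠ 0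
  /-- `G'/G(s) = 1/(s − 1) − ∑ Λ(n) n^{-s}` on `σ > 1`. -/
  logDeriv_eq : ∀ s : ℂ, 1 < s.re →
    deriv G s / G s = 1 / (s - 1) - LSeries (fun n ↦ (Λ n : ℂ)) s
  /-- `G(1) ≠ 0`. -/
  map_one_ne : G 1 ≠ 0
  /-- Polynomial growth in the strip `1 − η < σ ≤ 3`. -/
  growth : ∃ A C : ℝ, 0 ≤ A ∧ ∀ s : ℂ, 1 - η < s.re → s.re ≤ 3 → ‖G s‖ ≤ C * (|s.im| + 4) ^ A

namespace ClassicalZFRData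

variable {Λ : ℕ → ℝ} {G : ℂ → ℂ} {η : ℝ}

/-! ## The Dirichlet series `L(s) = ∑ Λ(n) n^{-s}` -/

/-- The real part of a term `Λ(n) n^{-(σ+it)}`: `Λ(n) n^{-σ} cos(t log n)`. [folklore] -/
theorem re_term_eq (Λ : ℕ → ℝ) (σ t : ℝ) (n : ℕ) :
    (LSeries.term (fun n ↦ (Λ n : ℂ)) (σ + t * I) n).re =
      if n = 0 then 0 else Λ n * Real.exp (-(Real.log n * σ)) * Real.cos (Real.log n * t) := by
  rcases eq_or_ne n 0 with rfl | hn
  · simp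
  rw [LSeries.term_of_ne_zero hn, if_neg hn, div_eq_mul_inv,
    Complex.cpow_def_of_ne_zero (Nat.cast_ne_zero.mpr hn), ← Complex.exp_neg,
    Complex.re_ofReal_mul, Complex.exp_re, mul_assoc]
  have hre : (-(Complex.log ↑n * (↑σ + ↑t * I))).re = -(Real.log n * σ) := by
    simp [Complex.mul_re, Complex.log_re, Complex.log_im, Complex.natCast_arg]
  have him : (-(Complex.log ↑n * (↑σ + ↑t * I))).im = -(Real.log n * t) := by
    simp [Complex.mul_im, Complex.log_re, Complex.log_im, Complex.natCast_arg]
  rw [hre, him, Real.cos_neg]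

/-- **The `3-4-1` inequality** (Montgomery–Vaughan Lemma 6.5, for a general Dirichlet series with
non-negative coefficients): for `σ > 1` and real `t`,
`3 Re L(σ) + 4 Re L(σ + it) + Re L(σ + 2it) ≥ 0`, `L(s) = ∑ Λ(n) n^{-s}`, because
`3 + 4 cos θ + cos 2θ = 2(1 + cos θ)² ≥ 0`. [cite: MontgomeryVaughan2007, Lemma 6.5] -/
theorem three_four_one (hΛ : ∀ n, 0 ≤ Λ n)
    (hsum : ∀ s : ℂ, 1 < s.re → LSeriesSummable (fun n ↦ (Λ n : ℂ)) s) {σ : ℝ} (hσ : 1 < σ)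
    (t : ℝ) :
    0 ≤ 3 * (LSeries (fun n ↦ (Λ n : ℂ)) σ).re +
      4 * (LSeries (fun n ↦ (Λ n : ℂ)) (σ + t * I)).re +
        (LSeries (fun n ↦ (Λ n : ℂ)) (σ + (2 * t) * I)).re := by
  set f : ℕ → ℂ := fun n ↦ (Λ n : ℂ) with hf
  have hsum' : ∀ u : ℝ, LSeriesSummable f (σ + u * I) := fun u ↦ hsum _ (by simp [hσ])
  have h0 : (σ : ℂ) = σ + (0 : ℝ) * I := by simp
  have h2 : (σ : ℂ) + (2 * t) * I = σ + ((2 * t : ℝ)) * I := by push_cast; ring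
  rw [h2]
  nth_rw 1 [h0]
  simp only [LSeries, Complex.re_tsum (hsum' _)]
  have hS : ∀ u : ℝ, Summable fun n ↦ (LSeries.term f (σ + u * I) n).re := fun u ↦
    (Complex.hasSum_re (hsum' u).hasSum).summable
  rw [← (hS 0).tsum_mul_left 3, ← (hS t).tsum_mul_left 4, ← ((hS 0).mul_left 3).tsum_add
    ((hS t).mul_left 4), ← (((hS 0).mul_left 3).add ((hS t).mul_left 4)).tsum_add (hS _)]
  refine tsum_nonneg fun n ↦ ?_
  simp only [hf, re_term_eq]
  rcases eq_or_ne n 0 with rfl | hn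
  · simp
  simp only [if_neg hn, mul_zero, Real.cos_zero, mul_one]
  have hE : 0 ≤ Real.exp (-(Real.log n * σ)) := (Real.exp_pos _).le
  have hcos : Real.cos (Real.log n * (2 * t)) = 2 * Real.cos (Real.log n * t) ^ 2 - 1 := by
    rw [← Real.cos_two_mul]; ring_nf
  rw [hcos]
  have hsq : 0 ≤ (1 + Real.cos (Real.log n * t)) ^ 2 := sq_nonneg _
  have := mul_nonneg (mul_nonneg (hΛ n) hE) hsq
  nlinarith

/-- For real `σ`, `L(σ) = ∑ Λ(n) n^{-σ}` is real and non-negative: `L(σ) = (Re L(σ) : ℂ)` with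
`0 ≤ Re L(σ)`. [folklore] -/
theorem LSeries_ofReal_eq (hΛ : ∀ n, 0 ≤ Λ n) (σ : ℝ) :
    LSeries (fun n ↦ (Λ n : ℂ)) σ = ((LSeries (fun n ↦ (Λ n : ℂ)) σ).re : ℂ) ∧
      0 ≤ (LSeries (fun n ↦ (Λ n : ℂ)) σ).re := by
  have h0 : 0 ≤ LSeries (fun n ↦ (Λ n : ℂ)) σ :=
    tsum_nonneg fun n ↦ LSeries.term_nonneg (by exact_mod_cast hΛ n) σ
  obtain ⟨hre, him⟩ := Complex.nonneg_iff.1 h0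
  refine ⟨Complex.ext (by simp) (by simp [← him]), hre⟩

/-- `|L(s)| ≤ L(σ')` for `1 < σ' ≤ Re s` (`Λ ≥ 0`; in particular `|L(σ + it)| ≤ L(σ)`).
[folklore] -/
theorem norm_LSeries_le_re (hΛ : ∀ n, 0 ≤ Λ n)
    (hsum : ∀ s : ℂ, 1 < s.re → LSeriesSummable (fun n ↦ (Λ n : ℂ)) s) {s : ℂ} {σ' : ℝ}
    (hσ' : 1 < σ') (hs : σ' ≤ s.re) :
    ‖LSeries (fun n ↦ (Λ n : ℂ)) s‖ ≤ (LSeries (fun n ↦ (Λ n : ℂ)) (σ' : ℂ)).re := by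
  set f : ℕ → ℂ := fun n ↦ (Λ n : ℂ)
  have hs1 : 1 < s.re := hσ'.trans_le hs
  have h1 : ‖LSeries f s‖ ≤ ∑' n, ‖LSeries.term f s n‖ := norm_tsum_le_tsum_norm (hsum s hs1).norm
  have h2 : ∀ n, ‖LSeries.term f (σ' : ℂ) n‖ = (LSeries.term f (σ' : ℂ) n).re := by
    intro n
    rcases eq_or_ne n 0 with rfl | hn
    · simp
    rw [LSeries.norm_term_eq, if_neg hn, LSeries.term_of_ne_zero hn, Complex.norm_real,
      Real.norm_of_nonneg (hΛ n)]
    have : (n : ℂ) ^ (σ' : ℂ) = ((n : ℝ) ^ σ' : ℝ) := by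
      rw [Complex.ofReal_cpow (Nat.cast_nonneg n)]; simp
    rw [this, ← Complex.ofReal_div, Complex.ofReal_re, Complex.ofReal_re]
  have hsum' : LSeriesSummable f (σ' : ℂ) := hsum _ (by simp [hσ'])
  have h3 : (LSeries f (σ' : ℂ)).re = ∑' n, (LSeries.term f (σ' : ℂ) n).re := by
    rw [LSeries, Complex.re_tsum hsum']
  have h4 : ∀ n, ‖LSeries.term f s n‖ ≤ ‖LSeries.term f (σ' : ℂ) n‖ := fun n ↦
    LSeries.norm_term_le_of_re_le_re f (by simp [hs]) n
  calc ‖LSeries f s‖ ≤ ∑' n, ‖LSeries.term f s n‖ := h1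
    _ ≤ ∑' n, ‖LSeries.term f (σ' : ℂ) n‖ :=
        Summable.tsum_le_tsum h4 (hsum s hs1).norm hsum'.norm
    _ = ∑' n, (LSeries.term f (σ' : ℂ) n).re := tsum_congr h2
    _ = (LSeries f (σ' : ℂ)).re := h3.symm

/-! ## `ℓ(s) = ∑ Λ(n) n^{-s}/log n` and the lower bound for `|G|` near `σ = 1` -/

/-- `ℓ(s) = ∑_{n ≥ 2} Λ(n) n^{-s} / log n` (the terms `n = 0, 1` vanish since `log 0 = log 1 = 0`
in Lean): for `Λ = Λ_K` this is `log ζ_K(s)`. [folklore] -/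
def logSeries (Λ : ℕ → ℝ) : ℂ → ℂ := LSeries (fun n ↦ ((Λ n / Real.log n : ℝ) : ℂ))

/-- `|Λ(n)/log n| ≤ Λ(n)/log 2` termwise (`Λ ≥ 0`). [folklore] -/
theorem norm_div_log_le (hΛ : ∀ n, 0 ≤ Λ n) (n : ℕ) :
    ‖((Λ n / Real.log n : ℝ) : ℂ)‖ ≤ ‖((Λ n / Real.log 2 : ℝ) : ℂ)‖ := by
  rw [Complex.norm_real, Complex.norm_real, Real.norm_of_nonneg (div_nonneg (hΛ n) (Real.log_natCast_nonneg n)),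
    Real.norm_of_nonneg (div_nonneg (hΛ n) (Real.log_nonneg one_le_two))]
  rcases lt_or_ge n 2 with hn | hn
  · interval_cases n <;> simp [div_nonneg (hΛ _) (Real.log_nonneg one_le_two)]
  · exact div_le_div_of_nonneg_left (hΛ n) (Real.log_pos one_lt_two)
      (Real.log_le_log two_pos (by exact_mod_cast hn))

/-- `ℓ` converges absolutely for `σ > 1`. [folklore] -/
theorem LSeriesSummable_div_log (hΛ : ∀ n, 0 ≤ Λ n)
    (hsum : ∀ s : ℂ, 1 < s.re → LSeriesSummable (fun n ↦ (Λ n : ℂ)) s) {s : ℂ} (hs : 1 < s.re) :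
    LSeriesSummable (fun n ↦ ((Λ n / Real.log n : ℝ) : ℂ)) s := by
  have h1 : LSeriesSummable (fun n ↦ ((Λ n / Real.log 2 : ℝ) : ℂ)) s := by
    have : (fun n ↦ ((Λ n / Real.log 2 : ℝ) : ℂ)) = (Real.log 2 : ℂ)⁻¹ • fun n ↦ (Λ n : ℂ) := by
      ext n; simp [div_eq_inv_mul]
    rw [this]
    exact LSeriesSummable.smul _ (hsum s hs)
  refine Summable.of_norm_bounded h1.norm fun n ↦ ?_
  exact LSeries.norm_term_le s (norm_div_log_le hΛ n)

/-- The abscissa of absolute convergence of `ℓ` is `≤ 1`. [folklore] -/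
theorem abscissaOfAbsConv_div_log_le (hΛ : ∀ n, 0 ≤ Λ n)
    (hsum : ∀ s : ℂ, 1 < s.re → LSeriesSummable (fun n ↦ (Λ n : ℂ)) s) :
    LSeries.abscissaOfAbsConv (fun n ↦ ((Λ n / Real.log n : ℝ) : ℂ)) ≤ 1 :=
  LSeries.abscissaOfAbsConv_le_of_forall_lt_LSeriesSummable fun y hy ↦
    LSeriesSummable_div_log hΛ hsum (by simp [hy])

/-- `ℓ'(s) = −∑ Λ(n) n^{-s}` for `σ > 1` (uses `Λ(1) = 0`). [folklore] -/
theorem hasDerivAt_logSeries (hΛ : ∀ n, 0 ≤ Λ n) (h1 : Λ 1 = 0)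
    (hsum : ∀ s : ℂ, 1 < s.re → LSeriesSummable (fun n ↦ (Λ n : ℂ)) s) {s : ℂ} (hs : 1 < s.re) :
    HasDerivAt (logSeries Λ) (-LSeries (fun n ↦ (Λ n : ℂ)) s) s := by
  have h := LSeries_hasDerivAt (f := fun n ↦ ((Λ n / Real.log n : ℝ) : ℂ)) (s := s)
    ((abscissaOfAbsConv_div_log_le hΛ hsum).trans_lt (by exact_mod_cast hs))
  have heq : LSeries (LSeries.logMul fun n ↦ ((Λ n / Real.log n : ℝ) : ℂ)) s =
      LSeries (fun n ↦ (Λ n : ℂ)) s := by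
    refine LSeries_congr (fun {n} hn ↦ ?_) s
    simp only [LSeries.logMul]
    rcases eq_or_ne n 1 with rfl | hn1
    · simp [h1]
    have hlog : Real.log n ≠ 0 := by
      have : (1 : ℝ) < n := by
        have : 2 ≤ n := by omega
        exact_mod_cast this
      exact (Real.log_pos this).ne'
    rw [← Complex.natCast_log, Complex.ofReal_div, ← mul_div_assoc, mul_div_right_comm,
      div_self (Complex.ofReal_ne_zero.2 hlog), one_mul]
  rwa [heq] at h

/-- For real `σ`, `Re ℓ(σ) ≥ 0`. [folklore] -/
theorem logSeries_ofReal_re_nonneg (hΛ : ∀ n, 0 ≤ Λ n) (σ : ℝ) : 0 ≤ (logSeries Λ σ).re := by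
  have h0 : 0 ≤ logSeries Λ σ :=
    tsum_nonneg fun n ↦ LSeries.term_nonneg
      (by exact_mod_cast div_nonneg (hΛ n) (Real.log_natCast_nonneg n)) σ
  exact (Complex.nonneg_iff.1 h0).1

/-- `Re ℓ(σ + it) ≥ −Re ℓ(σ)` (as `cos ≥ −1`, `Λ ≥ 0`), for `σ > 1`. [folklore] -/
theorem neg_re_logSeries_le (hΛ : ∀ n, 0 ≤ Λ n)
    (hsum : ∀ s : ℂ, 1 < s.re → LSeriesSummable (fun n ↦ (Λ n : ℂ)) s) {s : ℂ} (hs : 1 < s.re) :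
    -(logSeries Λ (s.re : ℂ)).re ≤ (logSeries Λ s).re := by
  have hb := norm_LSeries_le_re (Λ := fun n ↦ Λ n / Real.log n)
    (fun n ↦ div_nonneg (hΛ n) (Real.log_natCast_nonneg n))
    (fun s hs ↦ LSeriesSummable_div_log hΛ hsum hs) hs le_rfl
  simp only [logSeries]
  have := (abs_re_le_norm (LSeries (fun n ↦ ((Λ n / Real.log n : ℝ) : ℂ)) s)).trans hb
  linarith [neg_abs_le (LSeries (fun n ↦ ((Λ n / Real.log n : ℝ) : ℂ)) s).re]

/-- **Normalisation of `G` on `σ > 1`.** Under the hypotheses `G ≠ 0`,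
`G'/G = 1/(s−1) − ∑ Λ(n) n^{-s}` on `σ > 1` (and `Λ ≥ 0`, `Λ(1) = 0`), there is a constant `C ≠ 0`
with `G(s) = C (s − 1) exp(ℓ(s))` for `σ > 1`: the function `G(s) e^{−ℓ(s)}/(s − 1)` has zero
derivative on the (connected) half-plane. [folklore] -/
theorem exists_eq_const_mul_exp_logSeries (hΛ : ∀ n, 0 ≤ Λ n) (h1 : Λ 1 = 0)
    (hsum : ∀ s : ℂ, 1 < s.re → LSeriesSummable (fun n ↦ (Λ n : ℂ)) s)
    (hG : DifferentiableOn ℂ G {s : ℂ | 1 < s.re}) (hG0 : ∀ s : ℂ, 1 < s.re → G s ≠ 0)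
    (hlog : ∀ s : ℂ, 1 < s.re →
      deriv G s / G s = 1 / (s - 1) - LSeries (fun n ↦ (Λ n : ℂ)) s) :
    ∃ C : ℂ, C ≠ 0 ∧ ∀ s : ℂ, 1 < s.re → G s = C * (s - 1) * Complex.exp (logSeries Λ s) := by
  set U : Set ℂ := {s : ℂ | 1 < s.re} with hU
  have hUo : IsOpen U := continuous_re.isOpen_preimage _ isOpen_Ioi
  have hUc : IsPreconnected U := (convex_halfSpace_re_gt 1).isPreconnected
  set H : ℂ → ℂ := fun s ↦ G s * Complex.exp (-logSeries Λ s) / (s - 1) with hH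
  have hs1 : ∀ s ∈ U, s - 1 ≠ 0 := fun s hs h ↦ by
    have : s = 1 := sub_eq_zero.1 h
    simp [this, hU] at hs
  have hderiv : ∀ s ∈ U, HasDerivAt H 0 s := by
    intro s hs
    have hGd : HasDerivAt G (deriv G s) s := (hG.differentiableAt (hUo.mem_nhds hs)).hasDerivAt
    have hℓ := hasDerivAt_logSeries hΛ h1 hsum (s := s) hs
    have hE : HasDerivAt (fun z ↦ Complex.exp (-logSeries Λ z))
        (Complex.exp (-logSeries Λ s) * -(-LSeries (fun n ↦ (Λ n : ℂ)) s)) s := hℓ.neg.cexp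
    have hnum := hGd.fun_mul hE
    have hden : HasDerivAt (fun z : ℂ ↦ z - 1) 1 s := (hasDerivAt_id s).sub_const 1
    have hq := hnum.fun_div hden (hs1 s hs)
    have hG0s := hG0 s hs
    have hlogs := hlog s hs
    have hd : deriv G s = G s * (1 / (s - 1) - LSeries (fun n ↦ (Λ n : ℂ)) s) := by
      rw [← hlogs]; field_simp
    have hzero : (deriv G s * Complex.exp (-logSeries Λ s) +
        G s * (Complex.exp (-logSeries Λ s) * -(-LSeries (fun n ↦ (Λ n : ℂ)) s))) * (s - 1) -
        G s * Complex.exp (-logSeries Λ s) * 1 = 0 := by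
      rw [hd]
      field_simp [hs1 s hs]
      ring
    rw [hzero, zero_div] at hq
    exact hq
  have hHd : DifferentiableOn ℂ H U := fun s hs ↦ (hderiv s hs).differentiableAt.differentiableWithinAt
  have hH' : U.EqOn (deriv H) 0 := fun s hs ↦ (hderiv s hs).deriv
  have h2 : (2 : ℂ) ∈ U := by simp [hU]
  refine ⟨H 2, ?_, fun s hs ↦ ?_⟩
  · simp only [hH]
    exact div_ne_zero (mul_ne_zero (hG0 2 (by simp)) (Complex.exp_ne_zero _)) (by norm_num)
  · have := hUo.is_const_of_deriv_eq_zero hUc hHd hH' hs h2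
    rw [← this, hH]
    simp only
    field_simp [hs1 s hs]
    rw [mul_assoc, ← Complex.exp_add, neg_add_cancel, Complex.exp_zero, mul_one]

/-! ## Consequences of the hypotheses: constants -/

/-- The domain `σ > 1 − η` is open. [folklore] -/
theorem isOpen_dom (η : ℝ) : IsOpen {s : ℂ | 1 - η < s.re} :=
  continuous_re.isOpen_preimage _ isOpen_Ioi

/-- `1 < log 4` (as `e < 3 < 4`), so that `log(|t| + 4) > 1` throughout. [folklore] -/
theorem one_lt_log_four : 1 < Real.log 4 := by
  rw [Real.lt_log_iff_exp_lt (by norm_num)]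
  linarith [Real.exp_one_lt_three]

/-- `1 ≤ log(|t| + 4)`. [folklore] -/
theorem one_le_log_tau (t : ℝ) : 1 ≤ Real.log (|t| + 4) :=
  one_lt_log_four.le.trans (Real.log_le_log (by norm_num) (by linarith [abs_nonneg t]))

/-- `0 < log(|t| + 4)`. [folklore] -/
theorem log_tau_pos (t : ℝ) : 0 < Real.log (|t| + 4) := one_pos.trans_le (one_le_log_tau t)

/-- `log(2(|t| + 4)) ≤ 2 log(|t| + 4)` (as `2τ ≤ τ²` for `τ ≥ 2`). [folklore] -/
theorem log_two_mul_tau_le (t : ℝ) : Real.log (2 * (|t| + 4)) ≤ 2 * Real.log (|t| + 4) := by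
  have ht : 0 ≤ |t| := abs_nonneg t
  rw [← Real.log_rpow (by linarith), Real.rpow_two]
  exact Real.log_le_log (by linarith) (by nlinarith)

section Consequences

variable (h : ClassicalZFRData Λ G η)
include h

/-- **Lower bound for `|G|` to the right of `σ = 1`**: there is `c₁ > 0` with
`|G(s)| ≥ c₁ (σ − 1) |s − 1|` for `1 < σ ≤ 2` (from `G = C (s−1) e^{ℓ}`, `Re ℓ(σ+it) ≥ −Re ℓ(σ)`
and `|G(σ)| = |C| (σ − 1) e^{Re ℓ(σ)} ≤ C₀ 4^A`). This replaces "`|ζ(s₀)| ≫ 1` by the Euler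
product" of Montgomery–Vaughan p. 172. [folklore] -/
theorem norm_apply_ge : ∃ c₁ : ℝ, 0 < c₁ ∧ ∀ s : ℂ, 1 < s.re → s.re ≤ 2 →
    c₁ * (s.re - 1) * ‖s - 1‖ ≤ ‖G s‖ := by
  obtain ⟨C, hC0, hC⟩ := exists_eq_const_mul_exp_logSeries h.nonneg h.map_one h.summable
    (h.differentiableOn.mono fun s (hs : 1 < s.re) ↦ by
      simp only [Set.mem_setOf_eq]; linarith [h.eta_pos])
    h.ne_zero h.logDeriv_eq
  obtain ⟨A, C₀, hA, hgrowth⟩ := h.growth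
  -- `B = C₀ 4^A > 0` bounds `|G(σ)|`, `1 < σ ≤ 2`.
  set B : ℝ := C₀ * (4 : ℝ) ^ A with hB
  have hGσ : ∀ σ : ℝ, 1 < σ → σ ≤ 2 → ‖G σ‖ ≤ B := by
    intro σ h1 h2
    have := hgrowth σ (by simp; linarith [h.eta_pos]) (by simp; linarith)
    simpa [hB] using this
  have hBpos : 0 < B := by
    have h2 := hGσ 2 (by norm_num) (by norm_num)
    have : 0 < ‖G (2 : ℝ)‖ := norm_pos_iff.2 (h.ne_zero _ (by simp))
    push_cast at h2 this
    linarith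
  refine ⟨‖C‖ ^ 2 / B, by positivity, fun s hs hs2 ↦ ?_⟩
  set σ : ℝ := s.re with hσ
  have hσ1 : 1 < σ := hs
  -- `G s = C (s-1) e^{ℓ s}`, `G σ = C (σ - 1) e^{ℓ σ}`
  have hGs := hC s hs
  have hGσ' := hC σ (by simp [hσ1])
  have hns : ‖G s‖ = ‖C‖ * ‖s - 1‖ * Real.exp (logSeries Λ s).re := by
    rw [hGs, norm_mul, norm_mul, Complex.norm_exp]
  have hnσ : ‖G σ‖ = ‖C‖ * (σ - 1) * Real.exp (logSeries Λ σ).re := by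
    rw [hGσ', norm_mul, norm_mul, Complex.norm_exp]
    congr 2
    rw [show (σ : ℂ) - 1 = ((σ - 1 : ℝ) : ℂ) by push_cast; ring, Complex.norm_real,
      Real.norm_of_nonneg (by linarith)]
  have hre : -(logSeries Λ (σ : ℂ)).re ≤ (logSeries Λ s).re := neg_re_logSeries_le h.nonneg h.summable hs
  -- `e^{-Re ℓ σ} ≥ ‖C‖ (σ-1) / B`
  have h1 : ‖C‖ * (σ - 1) * Real.exp (logSeries Λ σ).re ≤ B := hnσ ▸ hGσ σ hσ1 hs2
  have hCpos : 0 < ‖C‖ := norm_pos_iff.2 hC0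
  have hexp : ‖C‖ * (σ - 1) / B ≤ Real.exp (-(logSeries Λ (σ : ℂ)).re) := by
    rw [div_le_iff₀ hBpos, Real.exp_neg]
    have hE : 0 < Real.exp (logSeries Λ (σ : ℂ)).re := Real.exp_pos _
    calc ‖C‖ * (σ - 1) = ‖C‖ * (σ - 1) * Real.exp (logSeries Λ ↑σ).re * (Real.exp (logSeries Λ ↑σ).re)⁻¹ := by
          field_simp
      _ ≤ B * (Real.exp (logSeries Λ ↑σ).re)⁻¹ := by gcongr
      _ = (Real.exp (logSeries Λ ↑σ).re)⁻¹ * B := mul_comm _ _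
  calc ‖C‖ ^ 2 / B * (σ - 1) * ‖s - 1‖ = ‖C‖ * ‖s - 1‖ * (‖C‖ * (σ - 1) / B) := by ring
    _ ≤ ‖C‖ * ‖s - 1‖ * Real.exp (-(logSeries Λ (σ : ℂ)).re) := by gcongr
    _ ≤ ‖C‖ * ‖s - 1‖ * Real.exp (logSeries Λ s).re := by gcongr
    _ = ‖G s‖ := hns.symm

/-- `G ≠ 0` on a disc `|s − 1| < r₁`, `0 < r₁ ≤ η` (continuity at `1`, `G(1) ≠ 0`). [folklore] -/
theorem exists_ball_ne_zero : ∃ r₁ : ℝ, 0 < r₁ ∧ r₁ ≤ η ∧ ∀ z : ℂ, ‖z - 1‖ < r₁ → G z ≠ 0 := by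
  have h1 : (1 : ℂ) ∈ {s : ℂ | 1 - η < s.re} := by simp [h.eta_pos]
  have hcont : ContinuousAt G 1 :=
    (h.differentiableOn.differentiableAt ((isOpen_dom η).mem_nhds h1)).continuousAt
  have hev := hcont.eventually_ne h.map_one_ne
  obtain ⟨ε, hε, hball⟩ := Metric.eventually_nhds_iff.1 hev
  refine ⟨min ε η, lt_min hε h.eta_pos, min_le_right _ _, fun z hz ↦ hball ?_⟩
  rw [dist_eq_norm]
  exact hz.trans_le (min_le_left _ _)

/-- `|G'/G(σ)| ≤ K₁` for real `1 < σ ≤ 2` (continuity on the compact segment `[1, 2]`, where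
`G ≠ 0`). [folklore] -/
theorem exists_bound_logDeriv_real : ∃ K₁ : ℝ, 0 ≤ K₁ ∧ ∀ σ : ℝ, 1 < σ → σ ≤ 2 →
    ‖deriv G σ / G σ‖ ≤ K₁ := by
  have hU := isOpen_dom η
  have hGa : AnalyticOnNhd ℂ G {s : ℂ | 1 - η < s.re} := h.differentiableOn.analyticOnNhd hU
  have hG'c : ContinuousOn (deriv G) {s : ℂ | 1 - η < s.re} := hGa.deriv.continuousOn
  have hGc : ContinuousOn G {s : ℂ | 1 - η < s.re} := h.differentiableOn.continuousOn
  have hmaps : MapsTo (fun σ : ℝ ↦ (σ : ℂ)) (Icc 1 2) {s : ℂ | 1 - η < s.re} := by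
    intro σ hσ
    simp only [Set.mem_setOf_eq, Complex.ofReal_re]
    linarith [hσ.1, h.eta_pos]
  have hne : ∀ σ ∈ Icc (1 : ℝ) 2, G σ ≠ 0 := by
    intro σ hσ
    rcases eq_or_lt_of_le hσ.1 with h1 | h1
    · rw [← h1]; exact_mod_cast h.map_one_ne
    · exact h.ne_zero _ (by simpa using h1)
  have hF : ContinuousOn (fun σ : ℝ ↦ deriv G σ / G σ) (Icc 1 2) :=
    (hG'c.comp Complex.continuous_ofReal.continuousOn hmaps).div
      (hGc.comp Complex.continuous_ofReal.continuousOn hmaps) hne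
  obtain ⟨K, hK⟩ := isCompact_Icc.exists_bound_of_continuousOn hF
  refine ⟨max K 0, le_max_right _ _, fun σ h1 h2 ↦ (hK σ ⟨h1.le, h2⟩).trans (le_max_left _ _)⟩

/-- `Re L(σ) ≤ 1/(σ − 1) + K₁` and `|L(σ + it)| ≤ 1/(σ − 1) + K₁` for `1 < σ ≤ 2`, from
`L(σ) = 1/(σ−1) − G'/G(σ)`. [folklore] -/
theorem exists_bound_LSeries : ∃ K₁ : ℝ, 0 ≤ K₁ ∧ ∀ s : ℂ, 1 < s.re → s.re ≤ 2 →
    (LSeries (fun n ↦ (Λ n : ℂ)) (s.re : ℂ)).re ≤ 1 / (s.re - 1) + K₁ ∧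
    ‖LSeries (fun n ↦ (Λ n : ℂ)) s‖ ≤ 1 / (s.re - 1) + K₁ := by
  obtain ⟨K₁, hK₁, hK⟩ := exists_bound_logDeriv_real h
  refine ⟨K₁, hK₁, fun s hs hs2 ↦ ?_⟩
  have hσ := h.logDeriv_eq (s.re : ℂ) (by simp [hs])
  have hL : LSeries (fun n ↦ (Λ n : ℂ)) (s.re : ℂ) = 1 / ((s.re : ℂ) - 1) - deriv G (s.re) / G (s.re) := by
    rw [hσ]; ring
  have hre : (LSeries (fun n ↦ (Λ n : ℂ)) (s.re : ℂ)).re ≤ 1 / (s.re - 1) + K₁ := by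
    rw [hL, Complex.sub_re]
    have h1 : (1 / ((s.re : ℂ) - 1)).re = 1 / (s.re - 1) := by
      rw [show (s.re : ℂ) - 1 = ((s.re - 1 : ℝ) : ℂ) by push_cast; ring, ← Complex.ofReal_one,
        ← Complex.ofReal_div, Complex.ofReal_re]
    rw [h1]
    have h2 := (abs_re_le_norm (deriv G ↑s.re / G ↑s.re)).trans (hK s.re hs hs2)
    linarith [neg_abs_le (deriv G ↑s.re / G ↑s.re).re]
  exact ⟨hre, (norm_LSeries_le_re h.nonneg h.summable hs le_rfl).trans hre⟩

/-- **Titchmarsh's Lemma α for `G` on the discs `|z − (1 + R/8 + it)| ≤ R`, `R = η/4`.**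
There is `E ≥ 0` such that for every real `t`, with `c = 1 + R/8 + it`: the zeros of `G` in
`|a − c| ≤ R` form a finite set `S` with multiplicities `m ≥ 1`, and
`G'/G(z) = ∑_{a ∈ S} m(a)/(z − a) + ψ(z)` for `|z − c| < R`, `G(z) ≠ 0`, where
`|ψ(z)| ≤ E log(|t| + 4)` for `|z − c| ≤ R/4` (the bound `|G| ≤ C₀(|t|+5)^A` on the disc and
`|G(c)| ≥ c₁ R²/64` give `log(M/|G(c)|) ≪ log(|t|+4)`). (Montgomery–Vaughan Lemma 6.4 for `ζ`.)
[cite: MontgomeryVaughan2007, Lemma 6.4] -/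
theorem exists_logDeriv_package : ∃ E : ℝ, 0 ≤ E ∧ ∀ t : ℝ,
    ∃ (S : Finset ℂ) (m : ℂ → ℕ) (ψ : ℂ → ℂ),
      (∀ a ∈ S, G a = 0 ∧ 0 < m a ∧ ‖a - (1 + η / 32 + t * I)‖ ≤ η / 4) ∧
      (∀ a, G a = 0 → ‖a - (1 + η / 32 + t * I)‖ ≤ η / 4 → a ∈ S) ∧
      (∀ z ∈ ball (1 + η / 32 + t * I) (η / 4), G z ≠ 0 →
        ψ z = deriv G z / G z - ∑ a ∈ S, (m a : ℂ) / (z - a)) ∧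
      (∀ z ∈ closedBall (1 + η / 32 + t * I) (η / 16), ‖ψ z‖ ≤ E * Real.log (|t| + 4)) := by
  obtain ⟨A, C₀, hA, hgrowth⟩ := h.growth
  obtain ⟨c₁, hc₁, hlow⟩ := norm_apply_ge h
  have hη := h.eta_pos
  have hη1 := h.eta_le_one
  set R : ℝ := η / 4 with hR
  have hRpos : 0 < R := by positivity
  -- lower bound at the centres
  set g₀ : ℝ := c₁ * (R / 8) * (R / 8) with hg₀
  have hg₀pos : 0 < g₀ := by positivity
  have hcentre : ∀ t : ℝ, g₀ ≤ ‖G (1 + η / 32 + t * I)‖ := by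
    intro t
    have hre : (1 + η / 32 + t * I : ℂ).re = 1 + R / 8 := by simp [hR]; ring
    have h1 := hlow (1 + η / 32 + t * I) (by rw [hre]; linarith) (by rw [hre]; linarith)
    rw [hre] at h1
    refine le_trans ?_ h1
    have hnorm : R / 8 ≤ ‖(1 + η / 32 + t * I : ℂ) - 1‖ := by
      have := abs_re_le_norm ((1 + η / 32 + t * I : ℂ) - 1)
      have hre' : ((1 + η / 32 + t * I : ℂ) - 1).re = R / 8 := by simp [hR]; ring
      rw [hre', abs_of_pos (by positivity)] at this
      exact this
    calc g₀ = c₁ * (1 + R / 8 - 1) * (R / 8) := by rw [hg₀]; ring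
      _ ≤ c₁ * (1 + R / 8 - 1) * ‖(1 + η / 32 + t * I : ℂ) - 1‖ :=
          mul_le_mul_of_nonneg_left hnorm (by ring_nf; positivity)
  -- `C₀ > 0`
  have hC₀ : 0 < C₀ := by
    have h1 := hgrowth (1 + η / 32) (by simp; linarith) (by simp; linarith)
    have h2 := hcentre 0
    simp only [Complex.ofReal_zero, zero_mul, add_zero] at h2
    have h3 : (0 : ℝ) < (|(1 + (η : ℂ) / 32).im| + 4) ^ A := Real.rpow_pos_of_pos (by positivity) _
    nlinarith
  -- the constant
  set B : ℝ := |Real.log (C₀ / g₀)| with hB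
  refine ⟨8 * (2 * A + B + 1) / R, by positivity, fun t ↦ ?_⟩
  set c : ℂ := 1 + η / 32 + t * I with hc
  have hcre : c.re = 1 + R / 8 := by simp [hc, hR]; ring
  have hcim : c.im = t := by simp [hc]
  -- holomorphy on `ball c η`
  have hdiff : DifferentiableOn ℂ G (ball c η) := by
    refine h.differentiableOn.mono fun z hz ↦ ?_
    simp only [Set.mem_setOf_eq]
    have h1 : |(z - c).re| ≤ ‖z - c‖ := abs_re_le_norm _
    rw [mem_ball_iff_norm] at hz
    rw [Complex.sub_re, hcre] at h1
    have := neg_abs_le ((z.re - (1 + R / 8)))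
    linarith
  -- the bound `M`
  set M : ℝ := C₀ * (|t| + 5) ^ A with hM
  have hMbound : ∀ z ∈ closedBall c (2 * R), ‖G z‖ ≤ M := by
    intro z hz
    rw [mem_closedBall_iff_norm] at hz
    have h1 : |(z - c).re| ≤ ‖z - c‖ := abs_re_le_norm _
    have h2 : |(z - c).im| ≤ ‖z - c‖ := abs_im_le_norm _
    rw [Complex.sub_re, hcre] at h1
    rw [Complex.sub_im, hcim] at h2
    have hre1 : 1 - η < z.re := by
      have := neg_abs_le (z.re - (1 + R / 8)); linarith
    have hre2 : z.re ≤ 3 := by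
      have := le_abs_self (z.re - (1 + R / 8)); linarith
    refine (hgrowth z hre1 hre2).trans ?_
    rw [hM]
    have him : |z.im| + 4 ≤ |t| + 5 := by
      have := abs_sub_abs_le_abs_sub z.im t
      linarith
    exact mul_le_mul_of_nonneg_left (Real.rpow_le_rpow (by positivity) him hA) hC₀.le
  obtain ⟨S, m, ψ, hS, hS', -, hψ, hψb, -⟩ :=
    Literature.Analysis.Complex.titchmarsh_logDeriv_sub_sum_of_differentiableOn hdiff (by rw [hR]; linarith)
      (norm_pos_iff.1 (hg₀pos.trans_le (hcentre t))) hRpos hMbound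
  refine ⟨S, m, ψ, hS, hS', hψ, fun z hz ↦ ?_⟩
  have hz' : z ∈ closedBall c (R / 4) := by rw [hR]; convert hz using 2; ring
  refine (hψb z hz').trans ?_
  -- `8 (log (M/‖G c‖) + 1)/R ≤ E log(|t|+4)`
  have hτ := one_le_log_tau t
  have hlogM : Real.log (M / ‖G c‖) ≤ (2 * A + B) * Real.log (|t| + 4) := by
    have hGc : 0 < ‖G c‖ := hg₀pos.trans_le (hcentre t)
    have hMle : M / ‖G c‖ ≤ (|t| + 5) ^ A * (C₀ / g₀) := by
      rw [hM, div_le_iff₀ hGc]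
      calc C₀ * (|t| + 5) ^ A = (|t| + 5) ^ A * (C₀ / g₀) * g₀ := by field_simp
        _ ≤ (|t| + 5) ^ A * (C₀ / g₀) * ‖G c‖ := by gcongr; exact hcentre t
    have hMpos : 0 < M / ‖G c‖ := div_pos (by rw [hM]; positivity) hGc
    calc Real.log (M / ‖G c‖) ≤ Real.log ((|t| + 5) ^ A * (C₀ / g₀)) := Real.log_le_log hMpos hMle
      _ = A * Real.log (|t| + 5) + Real.log (C₀ / g₀) := by
          rw [Real.log_mul (by positivity) (by positivity), Real.log_rpow (by positivity)]
      _ ≤ A * (2 * Real.log (|t| + 4)) + B * Real.log (|t| + 4) := by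
          gcongr
          · calc Real.log (|t| + 5) ≤ Real.log (2 * (|t| + 4)) :=
                  Real.log_le_log (by positivity) (by linarith [abs_nonneg t])
              _ ≤ 2 * Real.log (|t| + 4) := log_two_mul_tau_le t
          · calc Real.log (C₀ / g₀) ≤ B := le_abs_self _
              _ = B * 1 := (mul_one B).symm
              _ ≤ B * Real.log (|t| + 4) := by gcongr
      _ = (2 * A + B) * Real.log (|t| + 4) := by ring
  calc 8 * (Real.log (M / ‖G c‖) + 1) / R
      ≤ 8 * ((2 * A + B) * Real.log (|t| + 4) + 1 * Real.log (|t| + 4)) / R := by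
        gcongr; simpa using hτ
    _ = 8 * (2 * A + B + 1) / R * Real.log (|t| + 4) := by ring

omit h in
/-- `Re (1/(δ + iu)) ≤ 4/r₁²` for `0 < δ ≤ 1` and `|u| ≥ r₁/2 > 0`. [folklore] -/
theorem re_inv_le_of_le_abs {δ u r₁ : ℝ} (hδ : 0 < δ) (hδ1 : δ ≤ 1) (hr₁ : 0 < r₁)
    (hu : r₁ / 2 ≤ |u|) : ((δ + u * I : ℂ)⁻¹).re ≤ 4 / r₁ ^ 2 := by
  rw [Complex.inv_re]
  have hns : Complex.normSq (δ + u * I) = δ ^ 2 + u ^ 2 := by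
    rw [Complex.normSq_apply]; simp; ring
  have hre : (δ + u * I : ℂ).re = δ := by simp
  rw [hns, hre]
  have hu2 : r₁ ^ 2 / 4 ≤ u ^ 2 := by
    have : (r₁ / 2) ^ 2 ≤ |u| ^ 2 := pow_le_pow_left₀ (by positivity) hu 2
    rw [sq_abs] at this; linarith
  rw [div_le_div_iff₀ (by positivity) (by positivity)]
  nlinarith

omit h in
/-- The real part of `∑_{a ∈ S} m(a)/(s − a)` is non-negative when `Re a < Re s` for all
`a ∈ S`, and is at least `Re (1/(s − ρ))` for any `ρ ∈ S` with `m(ρ) ≥ 1`. [folklore] -/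
theorem re_sum_div_ge {S : Finset ℂ} {m : ℂ → ℕ} {s : ℂ} (hS : ∀ a ∈ S, a.re < s.re) :
    0 ≤ (∑ a ∈ S, (m a : ℂ) / (s - a)).re ∧
    ∀ ρ ∈ S, 1 ≤ m ρ → ((s - ρ)⁻¹).re ≤ (∑ a ∈ S, (m a : ℂ) / (s - a)).re := by
  have hterm : ∀ a ∈ S, ((m a : ℂ) / (s - a)).re = m a * ((s - a)⁻¹).re := by
    intro a _
    rw [div_eq_mul_inv, show ((m a : ℕ) : ℂ) = ((m a : ℝ) : ℂ) by simp, Complex.re_ofReal_mul]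
  have hinv : ∀ a ∈ S, 0 ≤ ((s - a)⁻¹).re := by
    intro a ha
    rw [Complex.inv_re]
    exact div_nonneg (by simp; linarith [hS a ha]) (Complex.normSq_nonneg _)
  have hnn : ∀ a ∈ S, 0 ≤ ((m a : ℂ) / (s - a)).re := fun a ha ↦ by
    rw [hterm a ha]; exact mul_nonneg (Nat.cast_nonneg _) (hinv a ha)
  rw [Complex.re_sum]
  refine ⟨Finset.sum_nonneg hnn, fun ρ hρ hm ↦ ?_⟩
  calc ((s - ρ)⁻¹).re ≤ ((m ρ : ℂ) / (s - ρ)).re := by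
        rw [hterm ρ hρ]
        have : (1 : ℝ) ≤ m ρ := by exact_mod_cast hm
        nlinarith [hinv ρ hρ]
    _ ≤ ∑ a ∈ S, ((m a : ℂ) / (s - a)).re := Finset.single_le_sum hnn hρ

/-- **The key inequality** (Montgomery–Vaughan, proof of Theorem 6.6, before the choice of `δ`):
there are `r₁ > 0` (with `G ≠ 0` on `|s − 1| < r₁`) and `E₁` such that for `|t| ≥ r₁/2`,
`0 < δ ≤ η/32` and every zero `β + it` of `G` with `β ≥ 1 − 7η/32`,
`4/(1 + δ − β) ≤ 3/δ + E₁ log(|t| + 4)`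
(from `3-4-1`, `Re L(1+δ) ≤ 1/δ + K₁`, and Lemma α at `1 + δ + it`, `1 + δ + 2it`).
[cite: MontgomeryVaughan2007, Theorem 6.6 (proof)] -/
theorem key_inequality : ∃ r₁ E₁ : ℝ, 0 < r₁ ∧ r₁ ≤ η ∧ (∀ z : ℂ, ‖z - 1‖ < r₁ → G z ≠ 0) ∧
    32 / η + 1 / r₁ ≤ E₁ ∧
    ∀ t : ℝ, r₁ / 2 ≤ |t| → ∀ δ : ℝ, 0 < δ → δ ≤ η / 32 → ∀ β : ℝ, 1 - 7 * η / 32 ≤ β →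
      G (β + t * I) = 0 → 4 / (1 + δ - β) ≤ 3 / δ + E₁ * Real.log (|t| + 4) := by
  obtain ⟨r₁, hr₁, hr₁η, hball⟩ := exists_ball_ne_zero h
  obtain ⟨K₁, hK₁, hK⟩ := exists_bound_LSeries h
  obtain ⟨E, hE, hpack⟩ := exists_logDeriv_package h
  have hη := h.eta_pos
  have hη1 := h.eta_le_one
  refine ⟨r₁, 3 * K₁ + 20 / r₁ ^ 2 + 6 * E + 32 / η + 1 / r₁, hr₁, hr₁η, hball,
    by
      have : 0 ≤ 3 * K₁ + 20 / r₁ ^ 2 + 6 * E := by positivity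
      linarith, ?_⟩
  intro t ht δ hδ hδη β hβ hzero
  set L : ℂ → ℂ := LSeries (fun n ↦ (Λ n : ℂ)) with hL
  have hτ := one_le_log_tau t
  have hlogpos := log_tau_pos t
  -- `β ≤ 1`
  have hβ1 : β ≤ 1 := by
    by_contra hcon
    exact h.ne_zero (β + t * I) (by simp; linarith) hzero
  have hδ1 : δ ≤ 1 := by linarith
  -- the three points
  set σ₀ : ℝ := 1 + δ with hσ₀
  have hσ₀1 : 1 < σ₀ := by linarith
  have hσ₀2 : σ₀ ≤ 2 := by linarith
  set s₀ : ℂ := σ₀ + t * I with hs₀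
  set s₀' : ℂ := σ₀ + (2 * t) * I with hs₀'
  have hs₀re : s₀.re = σ₀ := by simp [hs₀]
  have hs₀'re : s₀'.re = σ₀ := by simp [hs₀']
  -- (a) 3-4-1
  have h341 := three_four_one h.nonneg h.summable hσ₀1 t
  -- (b) `Re L(σ₀) ≤ 1/δ + K₁`
  have hb : (L σ₀).re ≤ 1 / δ + K₁ := by
    have := (hK σ₀ (by simp [hσ₀1]) (by simp [hσ₀2])).1
    simp only [Complex.ofReal_re] at this
    convert this using 2; rw [hσ₀]; ring
  -- (c) at `s₀`: `Re L(s₀) ≤ 4/r₁² + E log τ − 1/(1+δ−β)`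
  have hc : (L s₀).re ≤ 4 / r₁ ^ 2 + E * Real.log (|t| + 4) - 1 / (1 + δ - β) := by
    have hld := h.logDeriv_eq s₀ (by rw [hs₀re]; exact hσ₀1)
    have hLs : L s₀ = 1 / (s₀ - 1) - deriv G s₀ / G s₀ := by rw [hld]; ring
    obtain ⟨S, m, ψ, hS, hS', hψ, hψb⟩ := hpack t
    set c : ℂ := 1 + η / 32 + t * I with hcdef
    have hs₀c : ‖s₀ - c‖ ≤ η / 32 := by
      have : s₀ - c = ((δ - η / 32 : ℝ) : ℂ) := by
        simp only [hs₀, hcdef, hσ₀]; push_cast; ring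
      rw [this, Complex.norm_real, Real.norm_eq_abs, abs_le]
      constructor <;> linarith
    have hs₀ball : s₀ ∈ ball c (η / 4) := mem_ball_iff_norm.2 (by linarith)
    have hs₀cl : s₀ ∈ closedBall c (η / 16) := mem_closedBall_iff_norm.2 (by linarith)
    have hGs₀ : G s₀ ≠ 0 := h.ne_zero s₀ (by rw [hs₀re]; exact hσ₀1)
    have hψs₀ := hψ s₀ hs₀ball hGs₀
    -- `ρ = β + it ∈ S`
    set ρ : ℂ := β + t * I with hρ
    have hρS : ρ ∈ S := by
      refine hS' ρ hzero ?_
      have : ρ - c = ((β - 1 - η / 32 : ℝ) : ℂ) := by simp only [hρ, hcdef]; push_cast; ring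
      rw [this, Complex.norm_real, Real.norm_eq_abs, abs_le]
      constructor <;> linarith
    have hSre : ∀ a ∈ S, a.re < s₀.re := by
      intro a ha
      have hGa := (hS a ha).1
      have : a.re ≤ 1 := by
        by_contra hcon
        exact h.ne_zero a (by linarith) hGa
      rw [hs₀re]; linarith
    obtain ⟨hnn, hge⟩ := re_sum_div_ge (m := m) hSre
    have hρterm : ((s₀ - ρ)⁻¹).re = 1 / (1 + δ - β) := by
      have : s₀ - ρ = ((1 + δ - β : ℝ) : ℂ) := by simp only [hs₀, hρ, hσ₀]; push_cast; ring
      rw [this, ← Complex.ofReal_inv, Complex.ofReal_re, one_div]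
    have hsum_ge := hge ρ hρS (hS ρ hρS).2.1
    rw [hρterm] at hsum_ge
    -- real parts
    have hre1 : (1 / (s₀ - 1)).re ≤ 4 / r₁ ^ 2 := by
      have : s₀ - 1 = δ + t * I := by simp only [hs₀, hσ₀]; push_cast; ring
      rw [one_div, this]
      exact re_inv_le_of_le_abs hδ hδ1 hr₁ ht
    have hre2 : -(deriv G s₀ / G s₀).re ≤ E * Real.log (|t| + 4) - 1 / (1 + δ - β) := by
      have hEq : deriv G s₀ / G s₀ = ψ s₀ + ∑ a ∈ S, (m a : ℂ) / (s₀ - a) := by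
        rw [hψs₀]; ring
      rw [hEq, Complex.add_re]
      have := (abs_re_le_norm (ψ s₀)).trans (hψb s₀ hs₀cl)
      linarith [neg_abs_le (ψ s₀).re]
    rw [hLs, Complex.sub_re]
    linarith
  -- (d) at `s₀'`: `Re L(s₀') ≤ 4/r₁² + 2E log τ`
  have hd : (L s₀').re ≤ 4 / r₁ ^ 2 + 2 * E * Real.log (|t| + 4) := by
    have hld := h.logDeriv_eq s₀' (by rw [hs₀'re]; exact hσ₀1)
    have hLs : L s₀' = 1 / (s₀' - 1) - deriv G s₀' / G s₀' := by rw [hld]; ring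
    obtain ⟨S, m, ψ, hS, hS', hψ, hψb⟩ := hpack (2 * t)
    set c : ℂ := 1 + η / 32 + ((2 * t : ℝ) : ℂ) * I with hcdef
    have hs₀c : ‖s₀' - c‖ ≤ η / 32 := by
      have : s₀' - c = ((δ - η / 32 : ℝ) : ℂ) := by
        simp only [hs₀', hcdef, hσ₀]; push_cast; ring
      rw [this, Complex.norm_real, Real.norm_eq_abs, abs_le]
      constructor <;> linarith
    have hs₀ball : s₀' ∈ ball c (η / 4) := mem_ball_iff_norm.2 (by linarith)
    have hs₀cl : s₀' ∈ closedBall c (η / 16) := mem_closedBall_iff_norm.2 (by linarith)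
    have hGs₀ : G s₀' ≠ 0 := h.ne_zero s₀' (by rw [hs₀'re]; exact hσ₀1)
    have hψs₀ := hψ s₀' hs₀ball hGs₀
    have hSre : ∀ a ∈ S, a.re < s₀'.re := by
      intro a ha
      have hGa := (hS a ha).1
      have : a.re ≤ 1 := by
        by_contra hcon
        exact h.ne_zero a (by linarith) hGa
      rw [hs₀'re]; linarith
    obtain ⟨hnn, -⟩ := re_sum_div_ge (m := m) hSre
    have hre1 : (1 / (s₀' - 1)).re ≤ 4 / r₁ ^ 2 := by
      have : s₀' - 1 = δ + ((2 * t : ℝ) : ℂ) * I := by simp only [hs₀', hσ₀]; push_cast; ring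
      rw [one_div, this]
      refine re_inv_le_of_le_abs hδ hδ1 hr₁ ?_
      rw [abs_mul, abs_two]; linarith [abs_nonneg t]
    have hlog2 : Real.log (|2 * t| + 4) ≤ 2 * Real.log (|t| + 4) := by
      calc Real.log (|2 * t| + 4) ≤ Real.log (2 * (|t| + 4)) := by
            rw [abs_mul, abs_two]
            exact Real.log_le_log (by positivity) (by linarith [abs_nonneg t])
        _ ≤ 2 * Real.log (|t| + 4) := log_two_mul_tau_le t
    have hre2 : -(deriv G s₀' / G s₀').re ≤ 2 * E * Real.log (|t| + 4) := by
      have hEq : deriv G s₀' / G s₀' = ψ s₀' + ∑ a ∈ S, (m a : ℂ) / (s₀' - a) := by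
        rw [hψs₀]; ring
      rw [hEq, Complex.add_re]
      have := (abs_re_le_norm (ψ s₀')).trans (hψb s₀' hs₀cl)
      have hE2 : E * Real.log (|2 * t| + 4) ≤ E * (2 * Real.log (|t| + 4)) := by gcongr
      linarith [neg_abs_le (ψ s₀').re]
    rw [hLs, Complex.sub_re]
    linarith
  -- (e) combine
  have hs₀'eq : (σ₀ : ℂ) + 2 * ↑t * I = s₀' := by rw [hs₀']
  rw [hs₀'eq] at h341
  have hmain : 4 / (1 + δ - β) ≤ 3 / δ + (3 * K₁ + 20 / r₁ ^ 2 + 6 * E) * Real.log (|t| + 4) := by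
    have h1 : 3 * K₁ + 20 / r₁ ^ 2 ≤ (3 * K₁ + 20 / r₁ ^ 2) * Real.log (|t| + 4) := by
      have : 0 ≤ 3 * K₁ + 20 / r₁ ^ 2 := by positivity
      nlinarith
    change 0 ≤ 3 * (L ↑σ₀).re + 4 * (L s₀).re + (L s₀').re at h341
    linear_combination 3 * hb + 4 * hc + hd + h341 + h1
  calc 4 / (1 + δ - β) ≤ 3 / δ + (3 * K₁ + 20 / r₁ ^ 2 + 6 * E) * Real.log (|t| + 4) := hmain
    _ ≤ 3 / δ + (3 * K₁ + 20 / r₁ ^ 2 + 6 * E + 32 / η + 1 / r₁) * Real.log (|t| + 4) := by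
        have : 0 ≤ 32 / η + 1 / r₁ := by positivity
        have := mul_le_mul_of_nonneg_right
          (show 3 * K₁ + 20 / r₁ ^ 2 + 6 * E ≤ 3 * K₁ + 20 / r₁ ^ 2 + 6 * E + 32 / η + 1 / r₁ by
            linarith) hlogpos.le
        linarith

/-- **The classical zero-free region** (de la Vallée-Poussin; Montgomery–Vaughan Theorem 6.6
for `ζ`, p. 267 for `ζ_K`: "`ζ_K(s) ≠ 0` provided that `σ > 1 − c/log τ`, `τ = |t| + 4`, `c` a
constant depending on `K`"): under `ClassicalZFRData Λ G η` there is `c > 0` such that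
`G(s) ≠ 0` whenever `σ > 1 − η` and `σ > 1 − c/log(|t| + 4)`.
Proof: zeros with `|t| < r₁/2` are excluded by `G(1) ≠ 0` and continuity; for `|t| ≥ r₁/2` take
`δ = 1/(2E₁ log τ)` in `key_inequality`. [cite: MontgomeryVaughan2007, Theorem 6.6 and p. 267] -/
theorem zeroFree : ∃ c : ℝ, 0 < c ∧ ∀ s : ℂ, 1 - η < s.re →
    1 - c / Real.log (|s.im| + 4) < s.re → G s ≠ 0 := by
  obtain ⟨r₁, E₁, hr₁, hr₁η, hball, hE₁, hkey⟩ := key_inequality h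
  have hη := h.eta_pos
  have h32 : 0 < 32 / η := by positivity
  have hr1' : 0 < 1 / r₁ := by positivity
  have hE₁pos : 0 < E₁ := by linarith
  refine ⟨1 / (14 * E₁), by positivity, fun s hsdom hsreg hzero ↦ ?_⟩
  set β : ℝ := s.re with hβdef
  set t : ℝ := s.im with htdef
  set ℓ : ℝ := Real.log (|t| + 4) with hℓdef
  have hℓ : 1 ≤ ℓ := one_le_log_tau t
  have hℓpos : 0 < ℓ := log_tau_pos t
  have hs : s = β + t * I := (Complex.re_add_im s).symm.trans (by simp [hβdef, htdef, mul_comm])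
  -- `β ≤ 1`
  have hβ1 : β ≤ 1 := by
    by_contra hcon
    exact h.ne_zero s (not_le.1 hcon) hzero
  -- `1 - β < c/ℓ ≤ c`, and `c ≤ r₁/14`, `c ≤ η/448`
  have hcℓ : 1 / (14 * E₁) / ℓ ≤ 1 / (14 * E₁) := div_le_self (by positivity) hℓ
  have hβ2 : 1 - β < 1 / (14 * E₁) := by linarith
  have hcr : 1 / (14 * E₁) ≤ r₁ / 14 := by
    rw [div_le_div_iff₀ (by positivity) (by norm_num)]
    have : 1 ≤ E₁ * r₁ := by
      have h1 : 1 / r₁ * r₁ = 1 := by field_simp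
      nlinarith
    nlinarith
  have hcη : 1 / (14 * E₁) ≤ η / 448 := by
    rw [div_le_div_iff₀ (by positivity) (by norm_num)]
    have : 32 ≤ E₁ * η := by
      have h1 : 32 / η * η = 32 := by field_simp
      nlinarith
    nlinarith
  rcases lt_or_ge |t| (r₁ / 2) with ht | ht
  · -- near `s = 1`
    refine hball s ?_ hzero
    have h1 : ‖s - 1‖ ≤ |(s - 1).re| + |(s - 1).im| := Complex.norm_le_abs_re_add_abs_im _
    have h2 : (s - 1).re = β - 1 := by simp [hβdef]
    have h3 : (s - 1).im = t := by simp [htdef]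
    rw [h2, h3] at h1
    have h4 : |β - 1| = 1 - β := by rw [abs_sub_comm]; exact abs_of_nonneg (by linarith)
    linarith
  · -- the `3-4-1` argument with `δ = 1/(2 E₁ ℓ)`
    set δ : ℝ := 1 / (2 * E₁ * ℓ) with hδdef
    have hδpos : 0 < δ := by positivity
    have hδle : δ ≤ η / 32 := by
      rw [hδdef, div_le_div_iff₀ (by positivity) (by norm_num)]
      have : 32 ≤ E₁ * η := by
        have h1 : 32 / η * η = 32 := by field_simp
        nlinarith
      nlinarith
    have hβ3 : 1 - 7 * η / 32 ≤ β := by linarith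
    have hzero' : G (β + t * I) = 0 := by rw [← hs]; exact hzero
    have hk := hkey t ht δ hδpos hδle β hβ3 hzero'
    -- `3/δ + E₁ ℓ = 7 E₁ ℓ`
    have h7 : 3 / δ + E₁ * ℓ = 7 * E₁ * ℓ := by rw [hδdef]; field_simp; ring
    -- `1 + δ - β < 4/(7 E₁ ℓ)`
    have hgap : 1 + δ - β < 4 / (7 * E₁ * ℓ) := by
      have h1 : 1 - β < 1 / (14 * E₁) / ℓ := by linarith
      have h2 : δ + 1 / (14 * E₁) / ℓ = 4 / (7 * E₁ * ℓ) := by rw [hδdef]; field_simp; norm_num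
      linarith
    have hpos : 0 < 1 + δ - β := by linarith
    have hlt : 7 * E₁ * ℓ < 4 / (1 + δ - β) := by
      have := div_lt_div_of_pos_left (by norm_num : (0 : ℝ) < 4) hpos hgap
      have h3 : 4 / (4 / (7 * E₁ * ℓ)) = 7 * E₁ * ℓ := by field_simp
      rwa [h3] at this
    linarith

omit h in
/-- The elementary inequality behind Montgomery–Vaughan (6.11): if `s`, `s₁` have the same
ordinate, `Re s ≤ Re s₁ ≤ Re s + w`, and `a` lies to the left with `Re s − Re a ≥ d > 0`,
`Re s₁ − Re a ≥ κ > 0`, then `|1/(s−a) − 1/(s₁−a)| ≤ (w/κ)(w/d + 1) Re (1/(s₁ − a))`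
("`|s − ρ| ≍ |s₁ − ρ|`, so `1/(s−ρ) − 1/(s₁−ρ) ≪ Re 1/(s₁−ρ)`"). [cite: MontgomeryVaughan2007, Theorem 6.7 (proof)] -/
theorem norm_inv_sub_inv_le {s s₁ a : ℂ} {w d κ : ℝ} (hd : 0 < d) (hκ : 0 < κ)
    (him : s.im = s₁.im) (hσ : s.re ≤ s₁.re) (hws : s₁.re - s.re ≤ w)
    (hda : d ≤ s.re - a.re) (hκa : κ ≤ s₁.re - a.re) :
    ‖(s - a)⁻¹ - (s₁ - a)⁻¹‖ ≤ w / κ * (w / d + 1) * ((s₁ - a)⁻¹).re := by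
  have hw : 0 ≤ w := by linarith
  have hsa : d ≤ ‖s - a‖ := hda.trans ((Complex.abs_re_le_norm (s - a)).trans' (by simp [le_abs_self]))
  have hs₁a : κ ≤ ‖s₁ - a‖ :=
    hκa.trans ((Complex.abs_re_le_norm (s₁ - a)).trans' (by simp [le_abs_self]))
  have hsa0 : 0 < ‖s - a‖ := hd.trans_le hsa
  have hs₁a0 : 0 < ‖s₁ - a‖ := hκ.trans_le hs₁a
  have hsane : s - a ≠ 0 := norm_pos_iff.1 hsa0
  have hs₁ane : s₁ - a ≠ 0 := norm_pos_iff.1 hs₁a0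
  -- `‖s₁ - s‖ ≤ w`
  have hs₁s : ‖s₁ - s‖ ≤ w := by
    have : s₁ - s = ((s₁.re - s.re : ℝ) : ℂ) := by
      apply Complex.ext <;> simp [him]
    rw [this, Complex.norm_real, Real.norm_of_nonneg (by linarith)]
    exact hws
  -- the identity
  have hid : (s - a)⁻¹ - (s₁ - a)⁻¹ = (s₁ - s) / ((s - a) * (s₁ - a)) := by
    field_simp; ring
  rw [hid, norm_div, norm_mul]
  -- `‖s₁ - a‖ ≤ (w/d + 1) ‖s - a‖`
  have h1 : ‖s₁ - a‖ ≤ (w / d + 1) * ‖s - a‖ := by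
    calc ‖s₁ - a‖ = ‖(s₁ - s) + (s - a)‖ := by ring_nf
      _ ≤ ‖s₁ - s‖ + ‖s - a‖ := norm_add_le _ _
      _ ≤ w + ‖s - a‖ := by gcongr
      _ ≤ w / d * ‖s - a‖ + ‖s - a‖ := by
          gcongr
          calc w = w / d * d := by field_simp
            _ ≤ w / d * ‖s - a‖ := by gcongr
      _ = (w / d + 1) * ‖s - a‖ := by ring
  -- `Re (1/(s₁ - a)) ≥ κ / ‖s₁ - a‖²`
  have h2 : κ / ‖s₁ - a‖ ^ 2 ≤ ((s₁ - a)⁻¹).re := by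
    rw [Complex.inv_re, Complex.normSq_eq_norm_sq]
    gcongr
    simpa using hκa
  -- assemble
  have h3 : ‖s₁ - s‖ / (‖s - a‖ * ‖s₁ - a‖) ≤ w * (w / d + 1) / ‖s₁ - a‖ ^ 2 := by
    rw [div_le_div_iff₀ (by positivity) (by positivity)]
    calc ‖s₁ - s‖ * ‖s₁ - a‖ ^ 2 = ‖s₁ - s‖ * ‖s₁ - a‖ * ‖s₁ - a‖ := by ring
      _ ≤ w * ((w / d + 1) * ‖s - a‖) * ‖s₁ - a‖ := by gcongr
      _ = w * (w / d + 1) * (‖s - a‖ * ‖s₁ - a‖) := by ring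
  calc ‖s₁ - s‖ / (‖s - a‖ * ‖s₁ - a‖) ≤ w * (w / d + 1) / ‖s₁ - a‖ ^ 2 := h3
    _ = w / κ * (w / d + 1) * (κ / ‖s₁ - a‖ ^ 2) := by field_simp
    _ ≤ w / κ * (w / d + 1) * ((s₁ - a)⁻¹).re := by gcongr

/-- **`G'/G ≪ log τ` in the zero-free region** (Montgomery–Vaughan Theorem 6.7, (6.6); for
`ζ_K` see p. 267): under `ClassicalZFRData Λ G η` there are `c > 0` and `C` such that
`G(s) ≠ 0` and `|G'(s)/G(s)| ≤ C log(|t| + 4)` whenever `σ > 1 − η` and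
`σ ≥ 1 − c/log(|t| + 4)`. (Since `G` is regular at `s = 1`, no exception near the pole of
`ζ = G/(s−1)` is needed.) Proof as in MV: trivial for `σ ≥ 1 + η/(32 log τ)` from the Dirichlet
series; for smaller `σ` compare with `s₁ = 1 + η/(32 log τ) + it` through Lemma α on the disc
centred `1 + η/32 + it`, using `∑_ρ Re 1/(s₁ − ρ) ≪ log τ` and `norm_inv_sub_inv_le`.
[cite: MontgomeryVaughan2007, Theorem 6.7 (6.6)] -/
theorem norm_logDeriv_le : ∃ c : ℝ, 0 < c ∧ ∃ C : ℝ, 0 ≤ C ∧ ∀ s : ℂ, 1 - η < s.re →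
    1 - c / Real.log (|s.im| + 4) ≤ s.re →
      G s ≠ 0 ∧ ‖deriv G s / G s‖ ≤ C * Real.log (|s.im| + 4) := by
  obtain ⟨c₀, hc₀, hzf⟩ := zeroFree h
  obtain ⟨K₁, hK₁, hK⟩ := exists_bound_LSeries h
  obtain ⟨E, hE, hpack⟩ := exists_logDeriv_package h
  have hη := h.eta_pos
  have hη1 := h.eta_le_one
  set κ₁ : ℝ := η / 32 with hκ₁
  have hκ₁pos : 0 < κ₁ := by positivity
  set c : ℝ := min (c₀ / 4) κ₁ with hcdef
  have hcpos : 0 < c := lt_min (by positivity) hκ₁pos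
  have hc4 : c ≤ c₀ / 4 := min_le_left _ _
  have hcκ : c ≤ κ₁ := min_le_right _ _
  -- constants
  set q' : ℝ := (κ₁ + c₀ / 4) / κ₁ * ((κ₁ + c₀ / 4) / (c₀ / 4) + 1) with hq'
  have hq'pos : 0 < q' := by positivity
  set L2 : ℝ := (LSeries (fun n ↦ (Λ n : ℂ)) (2 : ℝ)).re with hL2
  have hL2 : 0 ≤ L2 := (LSeries_ofReal_eq h.nonneg 2).2
  set C : ℝ := E + (1 + q') * (2 / κ₁ + K₁ + E) + 1 + L2 with hCdef
  have hCpos : 0 ≤ C := by positivity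
  refine ⟨c, hcpos, C, hCpos, fun s hsdom hsreg ↦ ?_⟩
  set σ : ℝ := s.re with hσdef
  set t : ℝ := s.im with htdef
  set ℓ : ℝ := Real.log (|t| + 4) with hℓdef
  have hℓ : 1 ≤ ℓ := one_le_log_tau t
  have hℓpos : 0 < ℓ := log_tau_pos t
  have hs : s = σ + t * I := (Complex.re_add_im s).symm.trans (by simp [hσdef, htdef, mul_comm])
  -- `G s ≠ 0`
  have hGs : G s ≠ 0 := by
    refine hzf s hsdom ?_
    have h1 : c / ℓ ≤ c₀ / 4 / ℓ := by gcongr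
    have h2 : c₀ / 4 / ℓ < c₀ / ℓ := by
      rw [div_lt_div_iff_of_pos_right hℓpos]; linarith
    change 1 - c / ℓ ≤ σ at hsreg
    change 1 - c₀ / ℓ < σ
    linarith
  refine ⟨hGs, ?_⟩
  -- the Dirichlet-series bound for `σ > 1`
  have htriv : ∀ z : ℂ, 1 < z.re → z.re ≤ 2 →
      ‖deriv G z / G z‖ ≤ 2 / (z.re - 1) + K₁ := by
    intro z hz1 hz2
    rw [h.logDeriv_eq z hz1]
    have h1 : ‖1 / (z - 1)‖ ≤ 1 / (z.re - 1) := by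
      rw [norm_div, norm_one]
      apply one_div_le_one_div_of_le (by linarith)
      have := Complex.abs_re_le_norm (z - 1)
      simp only [Complex.sub_re, Complex.one_re] at this
      exact (le_abs_self _).trans this
    have h2 := (hK z hz1 hz2).2
    calc ‖1 / (z - 1) - LSeries (fun n ↦ (Λ n : ℂ)) z‖
        ≤ ‖1 / (z - 1)‖ + ‖LSeries (fun n ↦ (Λ n : ℂ)) z‖ := norm_sub_le _ _
      _ ≤ 1 / (z.re - 1) + (1 / (z.re - 1) + K₁) := add_le_add h1 h2
      _ = 2 / (z.re - 1) + K₁ := by ring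
  rcases le_or_gt σ (1 + κ₁ / ℓ) with hσ₁ | hσ₁
  · -- Case `σ ≤ σ₁ = 1 + κ₁/ℓ`: compare with `s₁`
    set σ₁ : ℝ := 1 + κ₁ / ℓ with hσ₁def
    set s₁ : ℂ := σ₁ + t * I with hs₁def
    have hs₁re : s₁.re = σ₁ := by simp [hs₁def]
    have hs₁im : s₁.im = t := by simp [hs₁def]
    have hκℓ : κ₁ / ℓ ≤ κ₁ := div_le_self hκ₁pos.le hℓ
    have hκℓpos : 0 < κ₁ / ℓ := by positivity
    have hσ₁1 : 1 < σ₁ := by linarith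
    have hσ₁2 : σ₁ ≤ 2 := by linarith
    have hGs₁ : G s₁ ≠ 0 := h.ne_zero s₁ (by rw [hs₁re]; exact hσ₁1)
    -- `‖G'/G s₁‖ ≤ (2/κ₁ + K₁) ℓ`
    have hG1 : ‖deriv G s₁ / G s₁‖ ≤ (2 / κ₁ + K₁) * ℓ := by
      have := htriv s₁ (by rw [hs₁re]; exact hσ₁1) (by rw [hs₁re]; exact hσ₁2)
      rw [hs₁re] at this
      have h1 : 2 / (σ₁ - 1) = 2 / κ₁ * ℓ := by
        rw [hσ₁def, add_sub_cancel_left, div_div_eq_mul_div]; ring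
      calc ‖deriv G s₁ / G s₁‖ ≤ 2 / (σ₁ - 1) + K₁ := this
        _ = 2 / κ₁ * ℓ + K₁ * 1 := by rw [h1, mul_one]
        _ ≤ 2 / κ₁ * ℓ + K₁ * ℓ := by gcongr
        _ = (2 / κ₁ + K₁) * ℓ := by ring
    -- the package at `t`
    obtain ⟨S, m, ψ, hS, hS', hψ, hψb⟩ := hpack t
    set cc : ℂ := 1 + η / 32 + t * I with hcc
    have hs₁cc : ‖s₁ - cc‖ ≤ η / 32 := by
      have : s₁ - cc = ((κ₁ / ℓ - η / 32 : ℝ) : ℂ) := by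
        simp only [hs₁def, hcc, hσ₁def]; push_cast; ring
      rw [this, Complex.norm_real, Real.norm_eq_abs, abs_le]
      constructor <;> linarith
    have hscc : ‖s - cc‖ ≤ η / 16 := by
      have : s - cc = ((σ - 1 - η / 32 : ℝ) : ℂ) := by
        rw [hs]; simp only [hcc]; push_cast; ring
      rw [this, Complex.norm_real, Real.norm_eq_abs, abs_le]
      have h1 : 1 - c / ℓ ≤ σ := hsreg
      have h2 : c / ℓ ≤ κ₁ := (div_le_self hcpos.le hℓ).trans hcκ
      constructor <;> linarith
    have hψs := hψ s (mem_ball_iff_norm.2 (by linarith)) hGs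
    have hψs₁ := hψ s₁ (mem_ball_iff_norm.2 (by linarith)) hGs₁
    have hψbs := hψb s (mem_closedBall_iff_norm.2 hscc)
    have hψbs₁ := hψb s₁ (mem_closedBall_iff_norm.2 (by linarith))
    -- zeros in `S` lie to the left: `Re a ≤ 1 - c₀/(2ℓ)`
    have hSre : ∀ a ∈ S, a.re ≤ 1 - c₀ / (2 * ℓ) := by
      intro a ha
      obtain ⟨hGa, -, hacc⟩ := hS a ha
      have hare : |(a - cc).re| ≤ η / 4 := (Complex.abs_re_le_norm _).trans hacc
      have haim : |(a - cc).im| ≤ η / 4 := (Complex.abs_im_le_norm _).trans hacc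
      have hccre : cc.re = 1 + η / 32 := by simp [hcc]
      have hccim : cc.im = t := by simp [hcc]
      rw [Complex.sub_re, hccre, abs_le] at hare
      rw [Complex.sub_im, hccim, abs_le] at haim
      have hadom : 1 - η < a.re := by linarith
      have hzf' := hzf a hadom
      have hale : a.re ≤ 1 - c₀ / Real.log (|a.im| + 4) := by
        by_contra hcon
        exact hzf' (not_le.1 hcon) hGa
      have hloga : Real.log (|a.im| + 4) ≤ 2 * ℓ := by
        calc Real.log (|a.im| + 4) ≤ Real.log (2 * (|t| + 4)) := by
              apply Real.log_le_log (by positivity)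
              have := abs_sub_abs_le_abs_sub a.im t
              have : |a.im - t| ≤ η / 4 := abs_le.2 ⟨by linarith, by linarith⟩
              linarith [abs_nonneg t]
          _ ≤ 2 * ℓ := log_two_mul_tau_le t
      have hlogapos : 0 < Real.log (|a.im| + 4) := log_tau_pos a.im
      have : c₀ / (2 * ℓ) ≤ c₀ / Real.log (|a.im| + 4) :=
        div_le_div_of_nonneg_left hc₀.le hlogapos hloga
      linarith
    -- the per-zero inequality
    have hzero_ineq : ∀ a ∈ S,
        ‖(s - a)⁻¹ - (s₁ - a)⁻¹‖ ≤ q' * ((s₁ - a)⁻¹).re := by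
      intro a ha
      have hare := hSre a ha
      have hsre : s.re = σ := rfl
      have h1 : 1 - c / ℓ ≤ σ := hsreg
      have hcℓ : c / ℓ ≤ c₀ / 4 / ℓ := by gcongr
      have key := norm_inv_sub_inv_le (s := s) (s₁ := s₁) (a := a)
        (w := (κ₁ + c₀ / 4) / ℓ) (d := c₀ / 4 / ℓ) (κ := κ₁ / ℓ) (by positivity) hκℓpos
        (by rw [hs₁im]) (by rw [hs₁re, hsre]; exact hσ₁)
        (by rw [hs₁re, hsre, hσ₁def, add_div]; linarith)
        (by
          rw [hsre]
          have : c₀ / 4 / ℓ + c₀ / 4 / ℓ = c₀ / (2 * ℓ) := by field_simp; ring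
          linarith)
        (by rw [hs₁re, hσ₁def]; linarith [(by positivity : 0 < c₀ / (2 * ℓ))])
      convert key using 2
      rw [hq']
      field_simp
    -- sum over the zeros
    have hSlt : ∀ a ∈ S, a.re < s₁.re := fun a ha ↦ by
      rw [hs₁re, hσ₁def]; linarith [hSre a ha, (by positivity : 0 < c₀ / (2 * ℓ))]
    obtain ⟨hsum_nn, -⟩ := re_sum_div_ge (m := m) hSlt
    have hsum_bound : ∑ a ∈ S, ‖(m a : ℂ) * ((s - a)⁻¹ - (s₁ - a)⁻¹)‖ ≤
        q' * (∑ a ∈ S, (m a : ℂ) / (s₁ - a)).re := by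
      rw [Complex.re_sum, Finset.mul_sum]
      refine Finset.sum_le_sum fun a ha ↦ ?_
      rw [norm_mul, Complex.norm_natCast, div_eq_mul_inv,
        show ((m a : ℕ) : ℂ) = ((m a : ℝ) : ℂ) by simp, Complex.re_ofReal_mul]
      calc (m a : ℝ) * ‖(s - a)⁻¹ - (s₁ - a)⁻¹‖ ≤ (m a : ℝ) * (q' * ((s₁ - a)⁻¹).re) := by
            gcongr; exact hzero_ineq a ha
        _ = q' * ((m a : ℝ) * ((s₁ - a)⁻¹).re) := by ring
    -- `Re Σ m/(s₁ - a) ≤ ‖G'/G s₁‖ + ‖ψ s₁‖`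
    have hsum_re : (∑ a ∈ S, (m a : ℂ) / (s₁ - a)).re ≤ (2 / κ₁ + K₁) * ℓ + E * ℓ := by
      have hEq : ∑ a ∈ S, (m a : ℂ) / (s₁ - a) = deriv G s₁ / G s₁ - ψ s₁ := by
        rw [hψs₁]; ring
      rw [hEq]
      calc (deriv G s₁ / G s₁ - ψ s₁).re ≤ ‖deriv G s₁ / G s₁ - ψ s₁‖ := Complex.re_le_norm _
        _ ≤ ‖deriv G s₁ / G s₁‖ + ‖ψ s₁‖ := norm_sub_le _ _
        _ ≤ (2 / κ₁ + K₁) * ℓ + E * ℓ := add_le_add hG1 hψbs₁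
    -- the decomposition of `G'/G s`
    have hdecomp : deriv G s / G s =
        ψ s + (deriv G s₁ / G s₁ - ψ s₁) + ∑ a ∈ S, (m a : ℂ) * ((s - a)⁻¹ - (s₁ - a)⁻¹) := by
      have h1 : deriv G s / G s = ψ s + ∑ a ∈ S, (m a : ℂ) / (s - a) := by rw [hψs]; ring
      have h2 : deriv G s₁ / G s₁ - ψ s₁ = ∑ a ∈ S, (m a : ℂ) / (s₁ - a) := by rw [hψs₁]; ring
      rw [h1, h2, add_assoc, ← Finset.sum_add_distrib]
      congr 1
      refine Finset.sum_congr rfl fun a _ ↦ ?_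
      ring
    calc ‖deriv G s / G s‖
        = ‖ψ s + (deriv G s₁ / G s₁ - ψ s₁) + ∑ a ∈ S, (m a : ℂ) * ((s - a)⁻¹ - (s₁ - a)⁻¹)‖ := by
          rw [hdecomp]
      _ ≤ ‖ψ s‖ + ‖deriv G s₁ / G s₁ - ψ s₁‖ + ‖∑ a ∈ S, (m a : ℂ) * ((s - a)⁻¹ - (s₁ - a)⁻¹)‖ :=
          norm_add₃_le
      _ ≤ E * ℓ + ((2 / κ₁ + K₁) * ℓ + E * ℓ) + q' * ((2 / κ₁ + K₁) * ℓ + E * ℓ) :=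
          add_le_add (add_le_add hψbs ((norm_sub_le _ _).trans (add_le_add hG1 hψbs₁)))
            ((norm_sum_le _ _).trans (hsum_bound.trans
              (mul_le_mul_of_nonneg_left hsum_re hq'pos.le)))
      _ = (E + (1 + q') * (2 / κ₁ + K₁ + E)) * ℓ := by ring
      _ ≤ C * ℓ := by
          gcongr
          rw [hCdef]
          linarith
  · -- Case `σ > 1 + κ₁/ℓ`
    have hσ1 : 1 < σ := by linarith [(by positivity : 0 < κ₁ / ℓ)]
    rcases le_or_gt σ 2 with hσ2 | hσ2
    · have := htriv s hσ1 hσ2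
      change ‖deriv G s / G s‖ ≤ 2 / (σ - 1) + K₁ at this
      have h1 : 2 / (σ - 1) ≤ 2 / κ₁ * ℓ := by
        rw [div_le_iff₀ (by linarith)]
        have : κ₁ / ℓ < σ - 1 := by linarith
        have h2 : 2 / κ₁ * ℓ * (κ₁ / ℓ) = 2 := by field_simp
        nlinarith [(by positivity : 0 < 2 / κ₁ * ℓ)]
      calc ‖deriv G s / G s‖ ≤ 2 / (σ - 1) + K₁ := this
        _ ≤ 2 / κ₁ * ℓ + K₁ * ℓ := by
            gcongr
            calc K₁ = K₁ * 1 := (mul_one _).symm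
              _ ≤ K₁ * ℓ := by gcongr
        _ = (2 / κ₁ + K₁) * ℓ := by ring
        _ ≤ C * ℓ := by
            gcongr
            rw [hCdef]
            have : 0 ≤ (1 + q') * (2 / κ₁ + K₁ + E) - (2 / κ₁ + K₁) := by
              have : (1 + q') * (2 / κ₁ + K₁ + E) - (2 / κ₁ + K₁) =
                  q' * (2 / κ₁ + K₁ + E) + E := by ring
              rw [this]; positivity
            linarith
    · -- `σ > 2`: everything is bounded
      rw [h.logDeriv_eq s hσ1]
      have h1 : ‖1 / (s - 1)‖ ≤ 1 := by
        rw [norm_div, norm_one]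
        apply div_le_one_of_le₀ _ (norm_nonneg _)
        have := Complex.abs_re_le_norm (s - 1)
        simp only [Complex.sub_re, Complex.one_re] at this
        have h3 : σ - 1 ≤ |s.re - 1| := le_abs_self _
        linarith
      have h2 : ‖LSeries (fun n ↦ (Λ n : ℂ)) s‖ ≤ L2 :=
        norm_LSeries_le_re h.nonneg h.summable one_lt_two hσ2.le
      calc ‖1 / (s - 1) - LSeries (fun n ↦ (Λ n : ℂ)) s‖
          ≤ ‖1 / (s - 1)‖ + ‖LSeries (fun n ↦ (Λ n : ℂ)) s‖ := norm_sub_le _ _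
        _ ≤ 1 + L2 := add_le_add h1 h2
        _ = (1 + L2) * 1 := (mul_one _).symm
        _ ≤ (1 + L2) * ℓ := by gcongr
        _ ≤ C * ℓ := by
            gcongr
            rw [hCdef]
            have : 0 ≤ E + (1 + q') * (2 / κ₁ + K₁ + E) := by positivity
            linarith

end Consequences

end ClassicalZFRData

end Literature.NumberTheory.LFunctions
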